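import Literature.NumberTheory.DiophantineGeometry.CatalanStickelbergerBridge
import Literature.NumberTheory.DiophantineGeometry.CatalanJacobiSumGeneral
import HarnessLib

/-!
# `(x - ζ_p)^{e_i}` is a `q`-th power in `ℚ(ζ_p)` (Schoof, Proposition 10.1 for the basis `e_i` of `I`)

[Schoof2009, Proposition 10.1]: for a non-zero solution of Catalan's equation `x^p - y^q = 1`
(`p, q` odd primes) and every `θ` in the ideal `I = (1 - ι) 𝒮` of `ℤ[G]`,
`G = Gal(ℚ(ζ_p)/ℚ)`, `𝒮` the Stickelberger ideal, the element `(x - ζ_p)^θ` is a `q`-th power in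
`ℚ(ζ_p)^*`. `CatalanStickelbergerBridge` proved this for `θ = (1 - ι) ι θ₂` (enough for
Theorem I). Here we prove it for the `ℤ`-basis `e_i = (1 - ι) f_i`, `1 ≤ i ≤ p - 2`, of `I`
([Schoof2009, Theorem 9.3 (ii)]), which is what the proof of Theorem III ([Schoof2009, Ch. 11])
consumes: writing `f_i = ∑_a m_{i,a} σ_a⁻¹` with `m_{i,a} = 1` iff `(ia mod p) + a ≥ p`
(`= [(i+1)a/p] - [ia/p]`, [Schoof2009, p. 57]) and `e_i = ∑_a u_{i,a} σ_a⁻¹`,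
`u_{i,a} = m_{i,a} - m_{i,-a} = ±1`,

* `Catalan.exists_pow_eq_prod_zpow_coeffU` — there is `α ∈ ℚ(ζ_p)^*` with
  `α^q = (x - ζ_p)^{e_i} = ∏_{a ∈ (ℤ/pℤ)ˣ} (x - ζ_p^{a⁻¹})^{u_{i,a}}`.

Inputs: `(x - ζ_p) = 𝔭 𝔞^q` (`Catalan.span_sub_zeta_pow_eq`, [Schoof2009, Prop. 7.2–7.3]);
the prime factors of `𝔞` have prime norm `≠ p` (`Catalan.absNorm_prime_of_mem_factors`);
Stickelberger's theorem for `f_i` on such primes (`Catalan.isPrincipal_prod_smul_filter_of_absNorm_prime`,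
[Schoof2009, Theorem 9.5]), so `𝔞^{f_i} = (γ)`; and the unit argument of
[Schoof2009, Lemma 7.1 (ii)] (`u^{1-ι}` and `(1 - ζ_p)^{1-ι} = -ζ_p` are roots of unity of order
dividing `2p`, hence `q`-th powers). No named fact is introduced; no definitions (the coefficient
function `M i a = m_{i,a}` is a parameter pinned down by an explicit `if`-term hypothesis `hM`,
as in `CatalanStickelbergerElements`).

## References

* R. Schoof, *Catalan's Conjecture*, Universitext, Springer 2009 [Schoof2009], Lemma 7.1,
  Theorem 9.3, Proposition 9.4, Theorem 9.5, Proposition 10.1, and Ch. 11 p. 77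
  ("Proposition 10.1 implies that every `θ ∈ I` satisfies the condition `(x - ζ_p)^θ = α^q`") —
  held, `lit read book:schoof2009-catalan-s-conjecture` (PDF pp. 121, 140–146, 148, 152).
-/

namespace Literature.NumberTheory.DiophantineGeometry

namespace Catalan

open Finset NumberField

open scoped Pointwise

section Cyclotomic

variable {p : ℕ} [hp : Fact p.Prime] {K : Type*} [Field K] [NumberField K]
  [IsCyclotomicExtension {p} ℚ K] {ζ : K}

/-- **[Schoof2009, Proposition 10.1] for `θ = e_i = (1 - ι) f_i`.** Let `p, q` be odd primes,
`x, y` non-zero integers with `x ^ p - y ^ q = 1`, `K` a `p`-th cyclotomic field with a primitive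
`p`-th root of unity `ζ`, and `1 ≤ i ≤ p - 2`. Then
`(x - ζ)^{e_i} = ∏_{a ∈ (ℤ/pℤ)ˣ} (x - ζ^{a⁻¹})^{u_{i,a}}` (`u_{i,a} = m_{i,a} - m_{i,-a} = ±1` the
coefficient of `σ_a⁻¹` in `e_i`, `σ_a : ζ ↦ ζ^a`) is a `q`-th power `α^q` of a non-zero
`α ∈ K`. [cite: Schoof2009, Proposition 10.1] -/
theorem exists_pow_eq_prod_zpow_coeffU (hζ : IsPrimitiveRoot ζ p) (hpo : Odd p) {q : ℕ}
    (hq : q.Prime) (hqo : Odd q) {x y : ℤ} (hx : x ≠ 0) (hy : y ≠ 0) (h : x ^ p - y ^ q = 1)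
    {M : ℕ → (ZMod p)ˣ → ℤ}
    (hM : ∀ (i : ℕ) (a : (ZMod p)ˣ),
      M i a = if p ≤ ((i : ZMod p) * a).val + (a : ZMod p).val then 1 else 0)
    {i : ℕ} (hi1 : 1 ≤ i) (hi2 : i ≤ p - 2) :
    ∃ α : K, α ≠ 0 ∧ α ^ q =
      ∏ a : (ZMod p)ˣ, ((x : K) - ζ ^ ((a⁻¹ : (ZMod p)ˣ) : ZMod p).val) ^ (M i a - M i (-a)) := by
  classical
  -- ### notation and elementary facts
  haveI : Fact (1 < p) := ⟨hp.out.one_lt⟩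
  haveI : NeZero p := ⟨hp.out.ne_zero⟩
  have hp3 : 3 ≤ p := by
    have := hp.out.two_le
    obtain ⟨k, hk⟩ := hpo
    omega
  obtain ⟨k, hk⟩ : ∃ k, p = k + 1 := ⟨p - 1, by omega⟩
  have hpq : p ≠ q := by
    rintro rfl
    exact pow_sub_pow_ne_one hpo hp3 hx hy h
  have hcop2p : q.Coprime (2 * p) := by
    refine Nat.Coprime.mul_right ?_ ?_
    · exact (Nat.coprime_primes hq Nat.prime_two).mpr fun h2 => by
        subst h2; exact (Nat.not_even_iff_odd.mpr hqo) even_two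
    · exact (Nat.coprime_primes hq hp.out).mpr (Ne.symm hpq)
  have h2p : 1 < 2 * p := by omega
  set σ_ := (IsCyclotomicExtension.Rat.galEquivZMod p K).symm with hσdef
  set z : 𝓞 K := hζ.toInteger with hzdef
  have hz : IsPrimitiveRoot z p := hζ.toInteger_isPrimitiveRoot
  have hzp : z ^ p = 1 := hz.pow_eq_one
  have hz0 : z ≠ 0 := hz.ne_zero hp.out.ne_zero
  have hzk : z ^ k * z = 1 := by rw [← pow_succ, ← hk, hzp]
  have hzK : (z : K) = ζ := hζ.coe_toInteger
  set π : 𝓞 K := z - 1 with hπdef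
  -- the exponents `m a = a⁻¹ mod p ∈ [1, p-1]`, with `σ_ a⁻¹ • z = z ^ m a`
  set m : (ZMod p)ˣ → ℕ := fun a => ((a⁻¹ : (ZMod p)ˣ) : ZMod p).val with hmdef
  have hm1 : ∀ a, 1 ≤ m a := fun a => by
    rw [hmdef]; simp only
    rw [Nat.one_le_iff_ne_zero, Ne, ZMod.val_eq_zero]
    exact (a⁻¹).ne_zero
  have hmp : ∀ a, m a < p := fun a => ZMod.val_lt _
  have hmneg : ∀ a, m (-a) = p - m a := fun a => by
    simp only [hmdef, inv_neg, Units.val_neg]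
    rw [ZMod.neg_val, if_neg (a⁻¹).ne_zero]
  have hσz : ∀ a, σ_ a⁻¹ • z = z ^ m a := fun a => galEquivZMod_symm_smul_toInteger hζ a⁻¹
  -- ### the ideal `𝔞` with `(x - z) = 𝔭 𝔞^q`, and `𝔞^{f_i} = (γ)` by Stickelberger
  obtain ⟨𝔞f, h𝔞f⟩ := span_sub_zeta_pow_eq hζ hq hpo hqo hx hy h
  obtain ⟨hA, hcopA⟩ := h𝔞f 1 (mem_Ico.mpr ⟨le_rfl, hp.out.one_lt⟩)
  rw [pow_one] at hA
  rw [← hzdef] at hA hcopA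
  set 𝔞 := 𝔞f 1 with h𝔞def
  have h𝔞0 : 𝔞 ≠ ⊥ := by
    intro h0
    rw [h0, ← Ideal.zero_eq_bot, zero_pow hq.ne_zero, mul_zero, Ideal.zero_eq_bot,
      Ideal.span_singleton_eq_bot, sub_eq_zero] at hA
    rw [← hA] at hzp
    have h2 : x ^ p = 1 := by exact_mod_cast hzp
    rcases Int.isUnit_iff.mp (IsUnit.of_pow_eq_one h2 hp.out.ne_zero) with rfl | rfl
    · exact hζ.zeta_sub_one_prime'.ne_zero (by rw [← hzdef, ← hA]; push_cast; ring)
    · rw [hpo.neg_pow, one_pow] at h2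
      norm_num at h2
  set P : (ZMod p)ˣ → Prop := fun a => p ≤ ((i : ZMod p) * a).val + (a : ZMod p).val with hPdef
  set S₁ := Finset.univ.filter (fun a : (ZMod p)ˣ => P a) with hS₁def
  have hprinc : (∏ a ∈ S₁, σ_ a⁻¹ • 𝔞).IsPrincipal :=
    isPrincipal_prod_smul_of_factors S₁ (fun a => σ_ a⁻¹) h𝔞0 fun Q hQ =>
      isPrincipal_prod_smul_filter_of_absNorm_prime hpo hζ Q
        (absNorm_prime_of_mem_factors hζ hq.pos hA hcopA hQ).1
        (absNorm_prime_of_mem_factors hζ hq.pos hA hcopA hQ).2 hi1 hi2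
  obtain ⟨γ, hγ⟩ : ∃ γ : 𝓞 K, ∏ a ∈ S₁, σ_ a⁻¹ • 𝔞 = Ideal.span {γ} :=
    ⟨_, (Ideal.span_singleton_generator _).symm⟩
  have hsmul0 : ∀ a, σ_ a⁻¹ • 𝔞 ≠ ⊥ := fun a => by
    rw [Ideal.pointwise_smul_def]
    exact (Ideal.map_eq_bot_iff_of_injective
      (MulSemiringAction.toRingEquiv _ (𝓞 K) (σ_ a⁻¹)).injective).not.mpr h𝔞0
  have hγ0 : γ ≠ 0 := by
    intro hγ0
    rw [hγ0, Ideal.span_singleton_zero, ← Ideal.zero_eq_bot, Finset.prod_eq_zero_iff] at hγ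
    obtain ⟨a, -, ha⟩ := hγ
    exact hsmul0 a (by rwa [Ideal.zero_eq_bot] at ha)
  -- ### conjugates of the ideal equation and the product `E = ∏_{a ∈ S₁} (x - z^(m a))`
  have hconj : ∀ a, Ideal.span {(x : 𝓞 K) - z ^ m a} = Ideal.span {π} * (σ_ a⁻¹ • 𝔞) ^ q := by
    intro a
    have := congrArg (fun I : Ideal (𝓞 K) => σ_ a⁻¹ • I) hA
    rwa [smul_mul', smul_pow', smul_span_zeta_sub_one hζ, smul_span_singleton_ringOfIntegers,
      smul_sub, smul_intCast_ringOfIntegers, hσz a] at this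
  set E : 𝓞 K := ∏ a ∈ S₁, ((x : 𝓞 K) - z ^ m a) with hEdef
  have hEideal : Ideal.span {E} = Ideal.span {π ^ S₁.card * γ ^ q} := by
    rw [hEdef, ← Ideal.prod_span_singleton, prod_congr rfl fun a _ => hconj a, prod_mul_distrib,
      prod_const, prod_pow, hγ, Ideal.span_singleton_pow, Ideal.span_singleton_pow,
      Ideal.span_singleton_mul_span_singleton]
  obtain ⟨u, hu⟩ : ∃ u : (𝓞 K)ˣ, π ^ S₁.card * γ ^ q * u = E :=
    Ideal.span_singleton_eq_span_singleton.mp hEideal.symm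
  -- ### complex conjugation `cc` on `𝓞 K`
  haveI : IsCMField K :=
    IsCyclotomicExtension.Rat.isCMField K (S := {p}) ⟨p, Set.mem_singleton p, by omega⟩
  set cc : 𝓞 K →+* 𝓞 K :=
    (RingOfIntegers.mapRingEquiv (IsCMField.complexConj K).toRingEquiv).toRingHom with hccdef
  have hccz : cc z = z ^ k := by
    apply RingOfIntegers.ext
    have h1 : (ζ ^ k) * ζ = 1 := by rw [← pow_succ, ← hk, hζ.pow_eq_one]
    calc ((cc z : 𝓞 K) : K) = IsCMField.complexConj K ζ := by rw [← hzK]; rfl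
      _ = ζ⁻¹ := complexConj_zeta hζ
      _ = ζ ^ k := (eq_inv_of_mul_eq_one_left h1).symm
      _ = ((z ^ k : 𝓞 K) : K) := by rw [RingOfIntegers.coe_eq_algebraMap, map_pow, ← RingOfIntegers.coe_eq_algebraMap, hzK]
  have hccx : cc (x : 𝓞 K) = x := map_intCast cc x
  have hccπ : cc π = -z ^ k * π := by
    rw [hπdef, map_sub, map_one, hccz]
    linear_combination hzk
  have hccpow : ∀ j, 1 ≤ j → j < p → cc ((x : 𝓞 K) - z ^ j) = x - z ^ (p - j) := by
    intro j hj1 hjp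
    rw [map_sub, hccx, map_pow, hccz, ← pow_mul]
    congr 1
    apply mul_right_cancel₀ (pow_ne_zero j hz0)
    rw [← pow_add, ← pow_add, Nat.sub_add_cancel hjp.le, hzp, show k * j + j = p * j by
      rw [hk]; ring, pow_mul, hzp, one_pow]
  set Ebar : 𝓞 K := ∏ a ∈ S₁, ((x : 𝓞 K) - z ^ (p - m a)) with hEbardef
  have hccE : cc E = Ebar := by
    rw [hEdef, map_prod]
    exact prod_congr rfl fun a _ => hccpow (m a) (hm1 a) (hmp a)
  -- the unit `u`: `u = μ · cc u` with `μ` a root of unity, `μ^(2p) = 1`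
  set μ : 𝓞 K := ((IsCMField.unitsMulComplexConjInv K u : (𝓞 K)ˣ) : 𝓞 K) with hμdef
  have hμ2p : μ ^ (2 * p) = 1 :=
    pow_two_mul_eq_one_of_mem_torsion hpo (IsCMField.unitsMulComplexConjInv K u).2
  have huμ : (u : 𝓞 K) = μ * cc u := by
    have h1 : ((IsCMField.unitsMulComplexConjInv K u : (𝓞 K)ˣ)) * IsCMField.unitsComplexConj K u
        = u := by
      rw [IsCMField.unitsMulComplexConjInv_apply, inv_mul_cancel_right]
    have h2 := congrArg Units.val h1
    rw [Units.val_mul] at h2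
    calc (u : 𝓞 K) = _ := h2.symm
      _ = μ * cc u := rfl
  -- ### the key identity `E · (cc γ)^q · (-z^k)^h = μ · γ^q · cc E` in `𝓞 K`
  have hkey : E * (cc γ ^ q * (-z ^ k) ^ S₁.card) = μ * γ ^ q * Ebar := by
    have hE' : E = π ^ S₁.card * γ ^ q * (μ * cc u) := by rw [← huμ, hu]
    have hEbar' : Ebar = (-z ^ k * π) ^ S₁.card * cc γ ^ q * cc u := by
      rw [← hccE, ← hu, map_mul, map_mul, map_pow, map_pow, hccπ]
    rw [hE', hEbar', mul_pow]
    ring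
  -- ### pass to `K`
  have hinjK := FaithfulSMul.algebraMap_injective (𝓞 K) K
  have hιz : algebraMap (𝓞 K) K z = ζ := hζ.coe_toInteger
  have hι0 : ∀ {w : 𝓞 K}, w ≠ 0 → algebraMap (𝓞 K) K w ≠ 0 := fun hw =>
    RingOfIntegers.coe_ne_zero_iff.mpr hw
  have hzk0 : ((-z ^ k) ^ S₁.card : 𝓞 K) ≠ 0 := pow_ne_zero _ (neg_ne_zero.mpr (pow_ne_zero _ hz0))
  set ρ : K := algebraMap (𝓞 K) K μ * (algebraMap (𝓞 K) K ((-z ^ k) ^ S₁.card))⁻¹ with hρdef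
  have hρ2p : ρ ^ (2 * p) = 1 := by
    have h1 : ((-z ^ k) ^ S₁.card : 𝓞 K) ^ (2 * p) = 1 := by
      have h2 : (-z ^ k : 𝓞 K) ^ (2 * p) = 1 := by
        rw [pow_mul, neg_sq, ← pow_mul, ← pow_mul, show k * (2 * p) = p * (2 * k) by ring,
          pow_mul, hzp, one_pow]
      rw [← pow_mul, mul_comm, pow_mul, h2, one_pow]
    rw [hρdef, mul_pow, inv_pow, ← map_pow, ← map_pow, hμ2p, h1, map_one, inv_one, mul_one]
  obtain ⟨ν₁, hν₁⟩ := exists_eq_pow_of_pow_eq_one_of_coprime hρ2p hcop2p h2p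
  have hρ0 : ρ ≠ 0 := by
    intro h0
    rw [h0, zero_pow (by omega : 2 * p ≠ 0)] at hρ2p
    exact zero_ne_one hρ2p
  have hν₁0 : ν₁ ≠ 0 := by
    intro h0
    rw [h0, zero_pow hq.ne_zero] at hν₁
    exact hρ0 hν₁
  have hccγ0 : cc γ ≠ 0 := (map_ne_zero_iff cc (RingOfIntegers.mapRingEquiv _).injective).mpr hγ0
  have hEbar0 : Ebar ≠ 0 := by
    rw [← hccE, map_ne_zero_iff cc (RingOfIntegers.mapRingEquiv _).injective, ← hu]
    exact mul_ne_zero (mul_ne_zero (pow_ne_zero _ hζ.zeta_sub_one_prime'.ne_zero)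
      (pow_ne_zero _ hγ0)) u.ne_zero
  -- `α = ν₁ γ / cc γ`
  refine ⟨ν₁ * algebraMap (𝓞 K) K γ / algebraMap (𝓞 K) K (cc γ), ?_, ?_⟩
  · exact div_ne_zero (mul_ne_zero hν₁0 (hι0 hγ0)) (hι0 hccγ0)
  -- `α ^ q = E / cc E`
  have hαq : (ν₁ * algebraMap (𝓞 K) K γ / algebraMap (𝓞 K) K (cc γ)) ^ q =
      algebraMap (𝓞 K) K E / algebraMap (𝓞 K) K Ebar := by
    rw [div_pow, mul_pow, ← hν₁, div_eq_div_iff (pow_ne_zero _ (hι0 hccγ0)) (hι0 hEbar0),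
      hρdef]
    have hkeyK := congrArg (algebraMap (𝓞 K) K) hkey
    simp only [map_mul, map_pow, map_neg] at hkeyK
    simp only [map_pow, map_neg]
    have hA0 : (-(algebraMap (𝓞 K) K z) ^ k) ^ S₁.card ≠ 0 :=
      pow_ne_zero _ (neg_ne_zero.mpr (pow_ne_zero _ (hι0 hz0)))
    have hinv : (-(algebraMap (𝓞 K) K z) ^ k) ^ S₁.card *
        ((-(algebraMap (𝓞 K) K z) ^ k) ^ S₁.card)⁻¹ = 1 := mul_inv_cancel₀ hA0
    linear_combination
      (algebraMap (𝓞 K) K E * (algebraMap (𝓞 K) K (cc γ)) ^ q) * hinv -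
        ((-(algebraMap (𝓞 K) K) z ^ k) ^ S₁.card)⁻¹ * hkeyK
  rw [hαq]
  -- ### `E / cc E = ∏_a (x - ζ^(m a))^(u_{i,a})`
  have hbase0 : ∀ a : (ZMod p)ˣ, (x : K) - ζ ^ m a ≠ 0 := by
    intro a h0
    have h0' : ((x : 𝓞 K) - z ^ m a : 𝓞 K) = 0 := by
      apply hinjK
      rw [map_sub, map_pow, map_zero, map_intCast, hιz]
      exact h0
    have hI : Ideal.span {(x : 𝓞 K) - z ^ m a} ≠ ⊥ := by
      rw [hconj a, Ne, Ideal.mul_eq_bot, not_or]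
      refine ⟨?_, ?_⟩
      · rw [Ideal.span_singleton_eq_bot]; exact hζ.zeta_sub_one_prime'.ne_zero
      · rw [← Ideal.zero_eq_bot, pow_eq_zero_iff hq.ne_zero, Ideal.zero_eq_bot]
        exact hsmul0 a
    exact hI (by rw [h0', Ideal.span_singleton_eq_bot])
  have hEK : algebraMap (𝓞 K) K E = ∏ a ∈ S₁, ((x : K) - ζ ^ m a) := by
    rw [hEdef, map_prod]
    refine prod_congr rfl fun a _ => ?_
    rw [map_sub, map_pow, map_intCast, hιz]
  have hEbarK : algebraMap (𝓞 K) K Ebar = ∏ a ∈ S₁, ((x : K) - ζ ^ (p - m a)) := by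
    rw [hEbardef, map_prod]
    refine prod_congr rfl fun a _ => ?_
    rw [map_sub, map_pow, map_intCast, hιz]
  -- numerator: `∏_a (x - ζ^(m a))^(M[i,a]) = E`
  have hnum : ∏ a : (ZMod p)ˣ, ((x : K) - ζ ^ m a) ^ (M i a) = ∏ a ∈ S₁, ((x : K) - ζ ^ m a) := by
    rw [hS₁def, Finset.prod_filter]
    refine prod_congr rfl fun a _ => ?_
    rw [hM]
    split_ifs <;> simp
  -- denominator: `∏_a (x - ζ^(m a))^(M[i,-a]) = cc E`
  have hden : ∏ a : (ZMod p)ˣ, ((x : K) - ζ ^ m a) ^ (M i (-a)) =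
      ∏ a ∈ S₁, ((x : K) - ζ ^ (p - m a)) := by
    have h1 : ∏ a : (ZMod p)ˣ, ((x : K) - ζ ^ m a) ^ (M i (-a)) =
        ∏ a : (ZMod p)ˣ, ((x : K) - ζ ^ m (-a)) ^ (M i a) := by
      refine Fintype.prod_equiv (Equiv.neg _) _ _ (fun a => ?_)
      simp only [Equiv.neg_apply, neg_neg]
    rw [h1, hS₁def, Finset.prod_filter]
    refine prod_congr rfl fun a _ => ?_
    rw [hmneg, hM]
    split_ifs <;> simp
  rw [hEK, hEbarK, ← hnum, ← hden, ← Finset.prod_div_distrib]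
  refine prod_congr rfl fun a _ => ?_
  rw [zpow_sub₀ (hbase0 a)]

end Cyclotomic

end Catalan

end Literature.NumberTheory.DiophantineGeometry
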